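import Literature.AnabelianGeometry.SemiGraphs.TemperedPiLevelDataOfTower
import Literature.AnabelianGeometry.SemiGraphs.TemperedLevelDataCpt
import HarnessLib

/-!
# The compact-form finite-level data of [SemiAnbd] Thm 3.7 (iii) from a Galois tower, modulo the identifications

Mochizuki, *Semi-graphs of anabelioids*, Publ. RIMS **42** (2006), §3, proof of Thm. 3.7 (iii),
author's manuscript p. 41 [cite: MochizukiSemiAnbd2006, Thm 3.7(iii) p.41] ("`H ⊆ π₁^temp(𝒢)` [compact] …
acts continuously on the semi-graph `𝒢_{∞,i}` … this action factors through a finite quotient … Since the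
semi-graphs `𝔾_j` are all finite …"), read with the author's *Comments* (2020), item (6).

ASSEMBLY (no new mathematics; seat abc-iut-L3-t8 gen 4, row (β)-ASM, brick ASM-1): the compact-form
(v4, cell ruling α12-1) twin of seat abc-iut-L3-t6's `GaloisLevelData.finiteLevelDataOfTower`
(`TemperedPiLevelDataOfTower.lean`).  For Galois level data `D` (seat abc-iut-L3-t9's `GaloisLevelData`),
a chart `c` with a continuous `ρ : c.G → D.temperedPi`, connected finite levels and a FINITE `𝔾`, the
files `TemperedPiTrees(Trans).lean` fill every tree / finite-level field of `FiniteLevelDataCpt`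
(`TemperedLevelDataCpt.lean`, seat abc-iut-L3-t6 gen 3); taken as INPUT, verbatim in the shapes of the
structure fields instantiated at these trees and at the finite levels `(D.S n).orbitGraph`, are the
identifications (I1) `fix`, (I2) `stab`, (I3) `edge` and the compact-form branch identification
(I4′)_cpt `stabBranchPairCpt'`.  Nothing here bears on [IUTchIII] Cor. 3.12.
-/

namespace Literature.AnabelianGeometry.SemiGraphs

namespace ProfiniteSemiGraph

namespace GaloisLevelData

open CategoryTheory Topology

universe u

variable {𝒢 : ProfiniteSemiGraph.{u}} (D : GaloisLevelData 𝒢) (h𝒢 : 𝒢.IsCountable)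
  (c : TemperedPiChart 𝒢) (ρ : c.G →* D.temperedPi h𝒢)
  (hconn : ∀ (n : ℕ) (p q : (D.S n).Point), (D.S n).SameComponent p q)
  [Finite 𝒢.graph.Vertex] [Finite 𝒢.graph.Edge] (hfin : ∀ n, (D.S n).IsFinite)

/-- **The compact-form finite-level data `FiniteLevelDataCpt` of Thm. 3.7 (iii) from a Galois tower**
(finite `𝔾`, finite connected levels), modulo (I1)–(I3) and the compact-form branch-level identification
(I4′)_cpt `stabBranchPairCpt'` taken as inputs; the trees, their actions and transitions, the finite
levels `𝔾_{S n}`, the graph-coverings `𝔾̃_n → 𝔾_{S n}`, the level actions and all compatibility squares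
are supplied by `TemperedPiTrees(Trans).lean` exactly as in `finiteLevelDataOfTower`.
[cite: MochizukiSemiAnbd2006, Thm 3.7(iii) p.41] -/
noncomputable def finiteLevelDataCptOfTower (hρ : Continuous ρ)
    (fix : ∀ (v : 𝒢.graph.Vertex) (H : Subgroup c.G), H ∈ verticialSubgroups c v →
      ∃ x : ∀ n, (D.tree n).Vertex, (∀ ⦃i j : ℕ⦄ (h : i ≤ j), (D.treeTrans h).vertexMap (x j) = x i) ∧
        ∀ g ∈ H, ∀ n, (D.treeAct h𝒢 n (ρ g)).hom.vertexMap (x n) = x n)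
    (stab : ∀ x : ∀ n, (D.tree n).Vertex,
      (∀ ⦃i j : ℕ⦄ (h : i ≤ j), (D.treeTrans h).vertexMap (x j) = x i) →
        ∃ (v : 𝒢.graph.Vertex) (H : Subgroup c.G), H ∈ verticialSubgroups c v ∧
          ∀ g : c.G, (∀ n, (D.treeAct h𝒢 n (ρ g)).hom.vertexMap (x n) = x n) → g ∈ H)
    (edge : ∀ (j₁ : ℕ) (ε : ∀ j : {j : ℕ // j₁ ≤ j}, (D.tree j.1).Edge),
      (∀ ⦃i j : {j : ℕ // j₁ ≤ j}⦄ (h : i.1 ≤ j.1), (D.treeTrans h).edgeMap (ε j) = ε i) →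
        ∃ (e : 𝒢.graph.Edge) (L : Subgroup c.G), L ∈ edgeLikeSubgroups c e ∧
          (∀ j, (D.treeProj j.1).edgeMap (ε j) = e) ∧
          ∀ g : c.G, (∀ j, (D.treeAct h𝒢 j.1 (ρ g)).hom.edgeMap (ε j) = ε j ∧
            ∀ b : (D.tree j.1).Branch, (D.tree j.1).edgeOf b = ε j →
              (D.treeAct h𝒢 j.1 (ρ g)).hom.branchMap b = b) → g ∈ L)
    (stabBranchPairCpt' : ∀ (C : Subgroup c.G), IsCompact (C : Set c.G) →
      ∀ (j₀ : ℕ) (w : ∀ i : {i : ℕ // j₀ ≤ i}, (D.S i.1).orbitGraph.Vertex)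
      (β β' : ∀ i : {i : ℕ // j₀ ≤ i}, (D.S i.1).orbitGraph.Branch),
      (∀ i, β i ≠ β' i ∧ (D.S i.1).orbitGraph.abuts (β i) = some (w i) ∧
        (D.S i.1).orbitGraph.abuts (β' i) = some (w i)) →
      (∀ ⦃i i' : {i : ℕ // j₀ ≤ i}⦄ (h : i.1 ≤ i'.1), (D.levelTrans h).vertexMap (w i') = w i ∧
        (D.levelTrans h).branchMap (β i') = β i ∧ (D.levelTrans h).branchMap (β' i') = β' i) →
      ∃ (Q : Type u) (_ : Group Q) (ιQ : c.G →* Q) (v : 𝒢.graph.Vertex) (b b' : 𝒢.graph.Branch)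
        (hb : 𝒢.graph.abuts b = some v) (hb' : 𝒢.graph.abuts b' = some v) (ψ : 𝒢.Gv v →* Q)
        (x x' : 𝒢.Gv v),
        Set.InjOn ιQ C ∧ Function.Injective ψ ∧ (b' ≠ b ∨ x⁻¹ * x' ∉ 𝒢.branchSubgroup b v hb) ∧
        ∀ g ∈ C, (∀ i, (D.levelAct h𝒢 hconn i.1 (ρ g)).hom.vertexMap (w i) = w i ∧
          (D.levelAct h𝒢 hconn i.1 (ρ g)).hom.branchMap (β i) = β i ∧
          (D.levelAct h𝒢 hconn i.1 (ρ g)).hom.branchMap (β' i) = β' i) →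
          ιQ g ∈ ((𝒢.branchSubgroup b v hb).map (MulAut.conj x).toMonoidHom).map ψ ⊓
            ((𝒢.branchSubgroup b' v hb').map (MulAut.conj x').toMonoidHom).map ψ) :
    FiniteLevelDataCpt.{0} 𝒢 c :=
  FiniteLevelDataCpt.mk (toVerticialLevelData := D.verticialLevelDataOfTower h𝒢 c ρ hρ fix stab edge)
    (level := fun n => (D.S n).orbitGraph)
    (finiteVertex := fun n => D.finite_levelVertex n (hfin n))
    (finiteBranch := fun n => D.finite_levelBranch n (hfin n))
    (quot := D.treeQuot)
    (quot_isImmersion := D.treeQuot_isImmersion)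
    (levelAct := fun n => (D.levelAct h𝒢 hconn n).comp ρ)
    (act_quot := fun n g => D.treeQuot_act h𝒢 hconn n (ρ g))
    (levelTrans := fun _ _ h => D.levelTrans h)
    (levelTrans_id := D.levelTrans_self)
    (levelTrans_comp := fun _ _ _ hij hjk => D.levelTrans_comp hij hjk)
    (levelTrans_act := fun _ _ h g => D.levelTrans_act h𝒢 hconn h (ρ g))
    (trans_quot := fun _ _ h => D.treeTrans_quot h)
    (stabBranchPairCpt' := stabBranchPairCpt')

/-- The tree-level part of the compact-form data is `verticialLevelDataOfTower` (so its (I1)–(I3) are the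
given `fix` / `stab` / `edge`). [cite: MochizukiSemiAnbd2006, Thm 3.7(iii) p.41] -/
theorem finiteLevelDataCptOfTower_toVerticialLevelData (hρ : Continuous ρ) (fix) (stab) (edge)
    (stabBranchPairCpt') :
    (D.finiteLevelDataCptOfTower h𝒢 c ρ hconn hfin hρ fix stab edge stabBranchPairCpt').toVerticialLevelData =
      D.verticialLevelDataOfTower h𝒢 c ρ hρ fix stab edge := rfl

/-- The finite levels of the compact-form data are the orbit graphs `𝔾_{S n}`.
[cite: MochizukiSemiAnbd2006, Thm 3.7(iii) p.41] -/
theorem finiteLevelDataCptOfTower_level (hρ : Continuous ρ) (fix) (stab) (edge) (stabBranchPairCpt')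
    (n : ℕ) :
    (D.finiteLevelDataCptOfTower h𝒢 c ρ hconn hfin hρ fix stab edge stabBranchPairCpt').level n =
      (D.S n).orbitGraph := rfl

end GaloisLevelData

end ProfiniteSemiGraph

end Literature.AnabelianGeometry.SemiGraphs
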